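import Summits.CriticalPhenomena.CardyFormulaZ2.Theorems.CardyBoundaryCoulombGasBoundaryDefectGaussianRStubClusterLocalityV2Part7

/-!
# Stub `stub_clusterLocalityV2` of line `rainbow-monomials-in-excursion-kernels` — Part 8:
# the Green half G1 in the `ℤ × ℤ` phrasing of the registered stub
# (crux `BoundaryDefectGaussianR`, stmt-CriticalPhenomena-14132)

The registered stub `stub_clusterLocalityV2` speaks of domains `V : Finset (ℤ × ℤ)`, flatness
`(((v.1 - a.1)² + (v.2 - a.2)² : ℤ) : ℝ) ≤ (M m)² → (v ∈ V ↔ 0 ≤ v.2 - a.2)`, and Green functions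
`dirichletGreen (V.image fun v ↦ ![v.1, v.2]) ![u.1, u.2] ![w.1, w.2]`, the second domain being
evaluated at the translated points `u - a + a'`, `w - a + a'`. This file transcribes the Green
locality theorem `green_locality` of Part 7 (phrased on `Site 2 = Fin 2 → ℤ`) into exactly these
terms (`green_locality_Z2`, registered sub-goal `s10_greenLocalityZ2`): for row points `u, w`
(`u.2 = w.2 = a.2`) within horizontal distance `m` of the anchor,
`|log G_V(u, w) - log G_{V'}(u - a + a', w - a + a')| ≤ C/M²` for `M ≥ C`. [folklore]
-/

noncomputable section

namespace Summit.CriticalPhenomena.CardyFormulaZ2.Cruxes.BoundaryDefectGaussianR.RainbowMonomialsInExcursionKernels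

open Finset Literature.Probability.LatticeModels

/-- The coordinate embedding `ℤ × ℤ → Site 2` evaluated. [folklore] -/
theorem vec2_apply (v : ℤ × ℤ) :
    (![v.1, v.2] : Site 2) 0 = v.1 ∧ (![v.1, v.2] : Site 2) 1 = v.2 := by simp

/-- Membership in the image of a `ℤ × ℤ`-domain under the coordinate embedding. [folklore] -/
theorem mem_image_vec2 (V : Finset (ℤ × ℤ)) (s : Site 2) :
    s ∈ V.image (fun v : ℤ × ℤ => (![v.1, v.2] : Fin 2 → ℤ)) ↔ (s 0, s 1) ∈ V := by
  rw [Finset.mem_image]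
  constructor
  · rintro ⟨v, hv, rfl⟩
    simpa using hv
  · intro h
    exact ⟨(s 0, s 1), h, by funext i; fin_cases i <;> rfl⟩

/-- Flatness transcribed: if `V ⊆ ℤ × ℤ` agrees with `{0 ≤ v.2 - a.2}` on the ball of radius `R`
about `a`, then its image in `Site 2` agrees with `{(![a.1,a.2]) 1 ≤ s 1}` on the ball about
`![a.1, a.2]`. [folklore] -/
theorem flat_image_vec2 {V : Finset (ℤ × ℤ)} {a : ℤ × ℤ} {R : ℝ}
    (hV : ∀ v : ℤ × ℤ, ((((v.1 - a.1) ^ 2 + (v.2 - a.2) ^ 2 : ℤ) : ℝ)) ≤ R ^ 2 →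
      (v ∈ V ↔ 0 ≤ v.2 - a.2)) :
    ∀ s : Site 2, (((s 0 - (![a.1, a.2] : Site 2) 0) ^ 2 +
      (s 1 - (![a.1, a.2] : Site 2) 1) ^ 2 : ℤ) : ℝ) ≤ R ^ 2 →
      (s ∈ V.image (fun v : ℤ × ℤ => (![v.1, v.2] : Fin 2 → ℤ)) ↔ (![a.1, a.2] : Site 2) 1 ≤ s 1) := by
  intro s hs
  rw [mem_image_vec2]
  have h := hV (s 0, s 1) (by simpa using hs)
  simp only at h
  rw [h]
  have e1 : (![a.1, a.2] : Site 2) 1 = a.2 := by simp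
  rw [e1]; omega

/-- **G1 in the `ℤ × ℤ` phrasing of the stub.** There is an absolute `C > 0` such that for all
finite `V, V' ⊆ ℤ × ℤ`, anchors `a, a'`, row points `u, w` (`u.2 = w.2 = a.2`) and reals
`m ≥ 1`, `M ≥ C`: if `V` (resp. `V'`) agrees with `{0 ≤ v.2 - a.2}` (resp. `{0 ≤ v.2 - a'.2}`) on
the ball of radius `M·m` about `a` (resp. `a'`) and `(u.1 - a.1)², (w.1 - a.1)² ≤ m²`, then the
Green functions of the embedded domains at `u, w` and at `u - a + a', w - a + a'` are positive
and their logarithms differ by at most `C/M²`. [folklore] -/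
theorem green_locality_Z2 : ∃ C : ℝ, 0 < C ∧ ∀ (V V' : Finset (ℤ × ℤ)) (a a' u w : ℤ × ℤ)
    (m M : ℝ), 1 ≤ m → C ≤ M →
    (∀ v : ℤ × ℤ, ((((v.1 - a.1) ^ 2 + (v.2 - a.2) ^ 2 : ℤ) : ℝ)) ≤ (M * m) ^ 2 →
      (v ∈ V ↔ 0 ≤ v.2 - a.2)) →
    (∀ v : ℤ × ℤ, ((((v.1 - a'.1) ^ 2 + (v.2 - a'.2) ^ 2 : ℤ) : ℝ)) ≤ (M * m) ^ 2 →
      (v ∈ V' ↔ 0 ≤ v.2 - a'.2)) →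
    u.2 = a.2 → w.2 = a.2 → (((u.1 - a.1) ^ 2 : ℤ) : ℝ) ≤ m ^ 2 →
    (((w.1 - a.1) ^ 2 : ℤ) : ℝ) ≤ m ^ 2 →
    0 < dirichletGreen (V.image (fun v : ℤ × ℤ => (![v.1, v.2] : Fin 2 → ℤ)))
      (![u.1, u.2] : Fin 2 → ℤ) (![w.1, w.2] : Fin 2 → ℤ) ∧
    0 < dirichletGreen (V'.image (fun v : ℤ × ℤ => (![v.1, v.2] : Fin 2 → ℤ)))
      (![(u - a + a').1, (u - a + a').2] : Fin 2 → ℤ) (![(w - a + a').1, (w - a + a').2] : Fin 2 → ℤ) ∧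
    |Real.log (dirichletGreen (V.image (fun v : ℤ × ℤ => (![v.1, v.2] : Fin 2 → ℤ)))
        (![u.1, u.2] : Fin 2 → ℤ) (![w.1, w.2] : Fin 2 → ℤ)) -
      Real.log (dirichletGreen (V'.image (fun v : ℤ × ℤ => (![v.1, v.2] : Fin 2 → ℤ)))
        (![(u - a + a').1, (u - a + a').2] : Fin 2 → ℤ)
        (![(w - a + a').1, (w - a + a').2] : Fin 2 → ℤ))| ≤ C / M ^ 2 := by
  obtain ⟨C, hC, h⟩ := green_locality
  refine ⟨C, hC, fun V V' a a' u w m M hm hM hV hV' hu2 hw2 hu1 hw1 => ?_⟩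
  have key := h (V.image (fun v : ℤ × ℤ => (![v.1, v.2] : Fin 2 → ℤ)))
    (V'.image (fun v : ℤ × ℤ => (![v.1, v.2] : Fin 2 → ℤ)))
    (![a.1, a.2]) (![a'.1, a'.2]) (![u.1, u.2]) (![w.1, w.2]) m M hm hM
    (flat_image_vec2 hV) (flat_image_vec2 hV') (by simp [hu2]) (by simp [hw2])
    (by simpa using hu1) (by simpa using hw1)
  have eu : (![u.1, u.2] : Site 2) - ![a.1, a.2] + ![a'.1, a'.2] =
      ![(u - a + a').1, (u - a + a').2] := by
    funext i; fin_cases i <;> simp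
  have ew : (![w.1, w.2] : Site 2) - ![a.1, a.2] + ![a'.1, a'.2] =
      ![(w - a + a').1, (w - a + a').2] := by
    funext i; fin_cases i <;> simp
  rw [eu, ew] at key
  exact key

/-! ### Registered sub-goal of the stub carried by this file -/

/-- **Sub-goal `s10_greenLocalityZ2`** (registered on stmt-CriticalPhenomena-14132): the Green
half G1 of `stub_clusterLocalityV2` in the stub's own `ℤ × ℤ` phrasing (`green_locality_Z2`).
[folklore] -/
theorem s10_greenLocalityZ2 : ∃ C : ℝ, 0 < C ∧ ∀ (V V' : Finset (ℤ × ℤ)) (a a' u w : ℤ × ℤ) (m M : ℝ), 1 ≤ m → C ≤ M → (∀ v : ℤ × ℤ, ((((v.1 - a.1) ^ 2 + (v.2 - a.2) ^ 2 : ℤ) : ℝ)) ≤ (M * m) ^ 2 → (v ∈ V ↔ 0 ≤ v.2 - a.2)) → (∀ v : ℤ × ℤ, ((((v.1 - a'.1) ^ 2 + (v.2 - a'.2) ^ 2 : ℤ) : ℝ)) ≤ (M * m) ^ 2 → (v ∈ V' ↔ 0 ≤ v.2 - a'.2)) → u.2 = a.2 → w.2 = a.2 → (((u.1 - a.1) ^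 2 : ℤ) : ℝ) ≤ m ^ 2 → (((w.1 - a.1) ^ 2 : ℤ) : ℝ) ≤ m ^ 2 → 0 < Literature.Probability.LatticeModels.dirichletGreen (V.image (fun v : ℤ × ℤ => (![v.1, v.2] : Fin 2 → ℤ))) (![u.1, u.2] : Fin 2 → ℤ) (![w.1, w.2] : Fin 2 → ℤ) ∧ 0 < Literature.Probability.LatticeModels.dirichletGreen (V'.image (fun v : ℤ × ℤ => (![v.1, v.2] : Fin 2 → ℤ))) (![(u - a + a').1, (u - a + a').2] : Fin 2 → ℤ) (![(w - a + a').1, (w - a + a').2] : Fin 2 → ℤ) ∧ |Real.log (Literature.Probability.LatticeModels.dirichletGreen (V.image (fun v : ℤ × ℤ => (![v.1, v.2] : Fin 2 → ℤ))) (![u.1, u.2] : Fin 2 → ℤ) (![w.1, w.2] : Fin 2 → ℤ)) - Real.log (Literature.Probability.LatticeModels.dirichletGreen (V'.image (fun v : ℤ × ℤ => (![v.1, v.2] : Fin 2 → ℤ))) (![(u - a + a').1, (u - a + a').2] : Fin 2 → ℤ) (![(w - a + a').1, (w - a + a').2] : Fin 2 → ℤ))| ≤ C / M ^ 2 :=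
  green_locality_Z2

end Summit.CriticalPhenomena.CardyFormulaZ2.Cruxes.BoundaryDefectGaussianR.RainbowMonomialsInExcursionKernels

end
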